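import Literature.NumberTheory.Sieve.HeathBrownCubicPolar
import Literature.NumberTheory.LFunctions.CubeRootTwoFieldPID
import Mathlib.NumberTheory.NumberField.Units.Regulator
import Mathlib.NumberTheory.NumberField.ClassNumber
import Mathlib.NumberTheory.NumberField.DedekindZeta
import HarnessLib

/-!
# The unit group, the regulator and the residue `γ₀` of `ζ_K` for `K = ℚ(2^{1/3})`

Support for §9 of D. R. Heath-Brown, *Primes represented by `x³ + 2y³`*, Acta Math. 186 (2001)
(the proof of Lemma 3.8 via Lemma 9.2), in the decomposition of **parity.S18**. On p. 60 the orbit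
integral `I(β)` is computed by the change of variables `(β(𝐱), β'(𝐱))` with Jacobian `π/(v·3√3)…`,
"an easy calculation now reveals that `I(β) = (πv/(3√3)) Δ³V = γ₀Δ³V`", `v = log ε₀`: the last
equality is the class number formula for `K`, `γ₀ = 2^{r₁}(2π)^{r₂} h R/(w√|d|)` with
`r₁ = r₂ = 1`, `h = 1`, `R = log ε₀`, `w = 2`, `d = −108`. This file PROVES that identity for the
tree's `gamma₀ = NumberField.dedekindZeta_residue K` (Mathlib's class-number-formula constant):

* the real embedding `realEmbK : θ ↦ ρ = 2^{1/3}` (`realEmbK_coe : σ₁(β) = ellO β`, the real linear form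
  `ell` of `HeathBrownCubicWindow`) and a complex embedding `cplxEmbK : θ ↦ ρω`, `ω = e^{2πi/3}`
  (`not_isReal_cplxEmb`); the places `wReal`, `wCplx`; **`nrRealPlaces K = 1`, `nrComplexPlaces K = 1`**,
  `infinitePlace_eq` (every place is one of the two), `rank_eq_one`, `torsionOrder_eq_two`,
  `classNumber_eq_one` (from `CubeRootTwoFieldPID.instIsPrincipalIdealRing`);
* **the unit theorem made explicit** (`exists_units_eq_unitGen_zpow`): every unit of `ℤ[2^{1/3}]` is
  `±u_E^n`, `n ∈ ℤ`, where `u_E` (`unitGen`) is a unit realising the constant `E = unitE` of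
  `HeathBrownCubicWindow` (the least value `> 1` of `σ₁` on units) — from `units_eq_one_of_ellO_mem`
  there; hence `closure_unitGen_sup_torsion`;
* **`regulator K = log E`** (`regulator_eq_log_unitE`: `regOfFamily_div_regulator` gives index `1`, and
  the regulator determinant at the real place is the `1 × 1` matrix `(log σ₁(u_E))`);
* **`gamma₀_eq : γ₀ = π log E/(3√3)`**.

We never need `E = ε₀ = 1 + 2^{1/3} + 2^{2/3}` (that `ε₀` is fundamental), only that `E` generates.

## References

* D. R. Heath-Brown, *Primes represented by `x³ + 2y³`*, Acta Math. 186 (2001), 1–84, §2 p. 6 (`γ₀`),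
  §9 p. 60. [cite: HeathBrownActa2001, §9 p. 60]
* D. A. Marcus, *Number Fields*, Springer (1977), Ch. 5 (units of pure cubic fields), Ch. 7 (class
  number formula). [folklore]

## Mathlib / tree search

Mathlib: `NumberField.dedekindZeta_residue_def`, `Units.regOfFamily_div_regulator`, `Units.regOfFamily_eq_det`,
`Units.torsionOrder_eq_two_of_odd_finrank`, `InfinitePlace.card_add_two_mul_card_eq_rank`,
`InfinitePlace.mult_isReal`, `classNumber_eq_one_iff`, `AdjoinRoot.lift`, `Matrix.det_eq_elem_of_subsingleton`.
Tree: `CubeRootTwoField` (`K`, `θ`, `cubicPolyRat_eq`, `finrank_K`, `coe_θint`), `CubeRootTwoFieldPID`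
(`discr_eq`, `instIsPrincipalIdealRing`), `HeathBrownCubicWindow` (`rho`, `ell`, `ellO`, `unitE`,
`exists_unit_ellO_eq_unitE`, `unitE_le_ellO_of_isUnit`, `units_eq_one_of_ellO_mem`, `ellO_units_inv`).
No signature / regulator computation for a cubic field existed (searched `nrRealPlaces`, `regulator`, `rank K`).
-/

noncomputable section

open Polynomial NumberField Finset

namespace Literature.NumberTheory.Sieve.CubicSieve

open LFunctions.CubeRootTwoField CubicPrimes NumberField.InfinitePlace NumberField.Units

/-! ### The real embedding `σ₁ : θ ↦ ρ` and a complex embedding `σ₂ : θ ↦ ρω` -/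

/-- `ρ = 2^{1/3}` is a root of `X³ − 2` in `ℝ`. [folklore] -/
theorem eval₂_cubicPolyRat_rho : cubicPolyRat.eval₂ (algebraMap ℚ ℝ) rho = 0 := by
  rw [cubicPolyRat_eq, eval₂_sub, eval₂_X_pow, eval₂_C, rho_pow_three]
  simp

/-- **The real embedding** `σ₁ : K = ℚ(θ) → ℝ`, `θ ↦ ρ = 2^{1/3}`. [folklore] -/
def realEmbK : K →+* ℝ := AdjoinRoot.lift (algebraMap ℚ ℝ) rho eval₂_cubicPolyRat_rho

/-- `σ₁(θ) = ρ`. [folklore] -/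
@[simp] theorem realEmbK_θ : realEmbK θ = rho := AdjoinRoot.lift_root _

/-- `σ₁(a + bθ + cθ²) = a + ρb + ρ²c = ell(a, b, c)`. [folklore] -/
theorem realEmbK_coordElt (v : ℤ × ℤ × ℤ) : realEmbK ((coordElt v : 𝓞 K) : K) = ell (castVec v) := by
  have hcoe : ((coordElt v : 𝓞 K) : K) = (v.1 : K) + (v.2.1 : K) * θ + (v.2.2 : K) * θ ^ 2 := by
    simp [coordElt, coe_θint]
  rw [hcoe, map_add, map_add, map_mul, map_mul, map_pow, map_intCast, map_intCast, map_intCast,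
    realEmbK_θ]
  simp only [ell, castVec]
  ring

/-- `σ₁(β) = ellO β` for `β ∈ 𝓞_K`. [folklore] -/
theorem realEmbK_coe (β : 𝓞 K) : realEmbK (β : K) = ellO β := by
  conv_lhs => rw [← coordElt_coordVec β]
  rw [realEmbK_coordElt]; rfl

/-- `ω = e^{2πi/3}`. [folklore] -/
def omega : ℂ := Complex.exp (2 * Real.pi * Complex.I / 3)

/-- `ω³ = 1`. [folklore] -/
theorem omega_pow_three : omega ^ 3 = 1 := by
  rw [omega, ← Complex.exp_nat_mul]
  have : ((3 : ℕ) : ℂ) * (2 * Real.pi * Complex.I / 3) = 2 * Real.pi * Complex.I := by push_cast; ring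
  rw [this, Complex.exp_two_pi_mul_I]

/-- `Im ω = √3/2 ≠ 0`. [folklore] -/
theorem omega_im : omega.im = Real.sqrt 3 / 2 := by
  rw [omega, Complex.exp_im]
  have hre : (2 * Real.pi * Complex.I / 3 : ℂ).re = 0 := by simp
  have him : (2 * Real.pi * Complex.I / 3 : ℂ).im = Real.pi - Real.pi / 3 := by
    simp; ring
  rw [hre, him, Real.exp_zero, one_mul, Real.sin_pi_sub, Real.sin_pi_div_three]

/-- `ρω` is a root of `X³ − 2` in `ℂ`. [folklore] -/
theorem eval₂_cubicPolyRat_rho_omega :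
    cubicPolyRat.eval₂ (algebraMap ℚ ℂ) ((rho : ℂ) * omega) = 0 := by
  rw [cubicPolyRat_eq, eval₂_sub, eval₂_X_pow, eval₂_C, mul_pow, omega_pow_three, mul_one]
  have h : ((rho : ℂ)) ^ 3 = 2 := by exact_mod_cast rho_pow_three
  rw [h]; simp

/-- **A complex embedding** `σ₂ : K → ℂ`, `θ ↦ ρω`. [folklore] -/
def cplxEmbK : K →+* ℂ := AdjoinRoot.lift (algebraMap ℚ ℂ) ((rho : ℂ) * omega) eval₂_cubicPolyRat_rho_omega

/-- `σ₂(θ) = ρω`. [folklore] -/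
@[simp] theorem cplxEmbK_θ : cplxEmbK θ = rho * omega := AdjoinRoot.lift_root _

/-- `Re ω = −1/2`. [folklore] -/
theorem omega_re : omega.re = -1 / 2 := by
  rw [omega, Complex.exp_re]
  have hre : (2 * Real.pi * Complex.I / 3 : ℂ).re = 0 := by simp
  have him : (2 * Real.pi * Complex.I / 3 : ℂ).im = Real.pi - Real.pi / 3 := by
    simp; ring
  rw [hre, him, Real.exp_zero, one_mul, Real.cos_pi_sub, Real.cos_pi_div_three]
  norm_num

/-- `ω = −1/2 + i√3/2`. [folklore] -/
theorem omega_eq : omega = ⟨-1 / 2, Real.sqrt 3 / 2⟩ := Complex.ext omega_re omega_im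

/-- **`σ₂` on coordinates is the `cplxEmb` of `HeathBrownCubicPolar`**:
`σ₂(a + bθ + cθ²) = a + bωρ + cω²ρ² = β'(a, b, c)`. [cite: HeathBrownActa2001, §9 p. 53] -/
theorem cplxEmbK_coordElt (v : ℤ × ℤ × ℤ) : cplxEmbK ((coordElt v : 𝓞 K) : K) = cplxEmb (castVec v) := by
  have hcoe : ((coordElt v : 𝓞 K) : K) = (v.1 : K) + (v.2.1 : K) * θ + (v.2.2 : K) * θ ^ 2 := by
    simp [coordElt, coe_θint]
  rw [hcoe, map_add, map_add, map_mul, map_mul, map_pow, map_intCast, map_intCast, map_intCast,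
    cplxEmbK_θ, omega_eq]
  have h3 : Real.sqrt 3 ^ 2 = 3 := Real.sq_sqrt (by norm_num)
  apply Complex.ext
  · simp [castVec, sq, Complex.mul_re, Complex.mul_im]
    linear_combination (-(rho ^ 2 * (v.2.2 : ℝ)) / 4) * h3
  · simp [castVec, sq, Complex.mul_re, Complex.mul_im]
    ring_nf

/-- `σ₂(β) = β'(β̂)` for `β ∈ 𝓞_K`. [folklore] -/
theorem cplxEmbK_coe (β : 𝓞 K) : cplxEmbK (β : K) = cplxEmb (castVec (coordVec β)) := by
  conv_lhs => rw [← coordElt_coordVec β]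
  rw [cplxEmbK_coordElt]

/-- `σ₂` is not a real embedding (`Im σ₂(θ) = ρ√3/2 ≠ 0`). [folklore] -/
theorem not_isReal_cplxEmb : ¬ ComplexEmbedding.IsReal cplxEmbK := by
  intro h
  rw [ComplexEmbedding.isReal_iff] at h
  have h1 : starRingEnd ℂ (cplxEmbK θ) = cplxEmbK θ := by
    conv_rhs => rw [← h]
    rfl
  rw [Complex.conj_eq_iff_im, cplxEmbK_θ, Complex.mul_im, Complex.ofReal_re, Complex.ofReal_im,
    zero_mul, add_zero, omega_im] at h1
  have : (0 : ℝ) < rho * (Real.sqrt 3 / 2) := mul_pos rho_pos (by positivity)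
  linarith

/-- **The real embedding into `ℂ`**, `σ₁` followed by `ℝ ⊆ ℂ`. [folklore] -/
def realEmbKC : K →+* ℂ := (algebraMap ℝ ℂ).comp realEmbK

/-- `realEmbKC` is a real embedding. [folklore] -/
theorem isReal_realEmbKC : ComplexEmbedding.IsReal realEmbKC := by
  rw [ComplexEmbedding.isReal_iff]
  refine RingHom.ext fun x => ?_
  rw [ComplexEmbedding.conjugate_coe_eq]
  simp [realEmbKC, Complex.conj_ofReal]

/-- **The real place `w₁`** of `K`. [folklore] -/
def wReal : InfinitePlace K := InfinitePlace.mk realEmbKC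

/-- **The complex place `w₂`** of `K`. [folklore] -/
def wCplx : InfinitePlace K := InfinitePlace.mk cplxEmbK

/-- `w₁` is real. [folklore] -/
theorem isReal_wReal : wReal.IsReal := isReal_mk_iff.mpr isReal_realEmbKC

/-- `w₂` is complex. [folklore] -/
theorem isComplex_wCplx : wCplx.IsComplex := isComplex_mk_iff.mpr not_isReal_cplxEmb

/-- `w₁ ≠ w₂`. [folklore] -/
theorem wReal_ne_wCplx : wReal ≠ wCplx := ne_of_isReal_isComplex isReal_wReal isComplex_wCplx

/-- `w₁(x) = |σ₁(x)|`. [folklore] -/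
theorem wReal_apply (x : K) : wReal x = |realEmbK x| := by
  rw [wReal, InfinitePlace.apply]
  simp [realEmbKC, Complex.norm_real]

/-- **`K` has signature `(1, 1)`**: one real place and one complex place. [folklore] -/
theorem nrRealPlaces_eq_one_and_nrComplexPlaces_eq_one :
    nrRealPlaces K = 1 ∧ nrComplexPlaces K = 1 := by
  classical
  have h := card_add_two_mul_card_eq_rank K
  rw [finrank_K] at h
  have hc : 1 ≤ nrComplexPlaces K := Fintype.card_pos_iff.mpr ⟨⟨wCplx, isComplex_wCplx⟩⟩
  omega

/-- `nrRealPlaces K = 1`. [folklore] -/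
theorem nrRealPlaces_eq_one : nrRealPlaces K = 1 := nrRealPlaces_eq_one_and_nrComplexPlaces_eq_one.1

/-- `nrComplexPlaces K = 1`. [folklore] -/
theorem nrComplexPlaces_eq_one : nrComplexPlaces K = 1 :=
  nrRealPlaces_eq_one_and_nrComplexPlaces_eq_one.2

/-- `K` has exactly two infinite places. [folklore] -/
theorem card_infinitePlace : Fintype.card (InfinitePlace K) = 2 := by
  rw [card_eq_nrRealPlaces_add_nrComplexPlaces, nrRealPlaces_eq_one, nrComplexPlaces_eq_one]

/-- Every infinite place of `K` is `w₁` or `w₂`. [folklore] -/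
theorem infinitePlace_eq (w : InfinitePlace K) : w = wReal ∨ w = wCplx := by
  classical
  by_contra h
  push Not at h
  have h3 : ({wReal, wCplx, w} : Finset (InfinitePlace K)).card = 3 := by
    rw [card_insert_of_notMem, card_insert_of_notMem, card_singleton]
    · simpa using h.2.symm
    · simp only [mem_insert, mem_singleton, not_or]
      exact ⟨wReal_ne_wCplx, h.1.symm⟩
  have := Finset.card_le_univ ({wReal, wCplx, w} : Finset (InfinitePlace K))
  rw [h3, card_infinitePlace] at this
  omega

/-- The unit rank of `K` is `1`. [folklore] -/
theorem rank_eq_one : rank K = 1 := by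
  rw [rank, card_infinitePlace]

/-- `K` has exactly the two roots of unity `±1` (odd degree). [folklore] -/
theorem torsionOrder_eq_two : torsionOrder K = 2 :=
  torsionOrder_eq_two_of_odd_finrank (by rw [finrank_K]; decide)

/-- The class number of `K` is `1`. [folklore] -/
theorem classNumber_eq_one : classNumber K = 1 :=
  (classNumber_eq_one_iff).mpr inferInstance

/-! ### The unit group: every unit is `±u_E^n` -/

/-- **The generating unit `u_E`**: a unit with `σ₁(u_E) = E`, the least value `> 1` of `σ₁` on the
units (`unitE` of `HeathBrownCubicWindow`; in fact `E = ε₀ = 1 + 2^{1/3} + 2^{2/3}`, which we do not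
need). [folklore] -/
def unitGen : (𝓞 K)ˣ := exists_unit_ellO_eq_unitE.choose

/-- `σ₁(u_E) = E`. [folklore] -/
theorem ellO_unitGen : ellO (unitGen : 𝓞 K) = unitE := exists_unit_ellO_eq_unitE.choose_spec

/-- `σ₁(u^n) = σ₁(u)^n` for a unit `u` and `n ∈ ℕ`. [folklore] -/
theorem ellO_units_pow (u : (𝓞 K)ˣ) (n : ℕ) : ellO ((u ^ n : (𝓞 K)ˣ) : 𝓞 K) = ellO (u : 𝓞 K) ^ n := by
  rw [Units.val_pow_eq_pow_val, ellO_pow]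

/-- `σ₁(u^n) = σ₁(u)^n` for a unit `u` and `n ∈ ℤ`. [folklore] -/
theorem ellO_units_zpow (u : (𝓞 K)ˣ) (n : ℤ) : ellO ((u ^ n : (𝓞 K)ˣ) : 𝓞 K) = ellO (u : 𝓞 K) ^ n := by
  obtain ⟨k, rfl | rfl⟩ := Int.eq_nat_or_neg n
  · rw [zpow_natCast, zpow_natCast, ellO_units_pow]
  · rw [zpow_neg, zpow_natCast, zpow_neg, zpow_natCast, ellO_units_inv, ellO_units_pow]

/-- **The unit theorem for `ℤ[2^{1/3}]`, made explicit**: every unit is `±u_E^n` for some `n ∈ ℤ`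
(Dirichlet: rank `r₁ + r₂ − 1 = 1`, torsion `{±1}`; here from the minimality of `E`: if
`E^n < σ₁(±u) ≤ E^{n+1}` then `±u·u_E^{−(n+1)}` is a unit with `σ₁ ∈ (E⁻¹, 1]`, hence `= 1` by
`units_eq_one_of_ellO_mem`). [folklore] -/
theorem exists_units_eq_unitGen_zpow (u : (𝓞 K)ˣ) :
    ∃ n : ℤ, u = unitGen ^ n ∨ u = -unitGen ^ n := by
  have hE := one_lt_unitE
  have hE0 := unitE_pos
  -- choose the sign `s` with `σ₁(s u) > 0`
  obtain ⟨s, hs, hpos⟩ : ∃ s : (𝓞 K)ˣ, (s = 1 ∨ s = -1) ∧ 0 < ellO ((s * u : (𝓞 K)ˣ) : 𝓞 K) := by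
    rcases lt_or_gt_of_ne (ellO_ne_zero (Units.ne_zero u)) with h | h
    · refine ⟨-1, Or.inr rfl, ?_⟩
      rw [Units.val_mul, Units.val_neg, Units.val_one, neg_one_mul, ellO_neg]; linarith
    · exact ⟨1, Or.inl rfl, by rw [one_mul]; exact h⟩
  set x := ellO ((s * u : (𝓞 K)ˣ) : 𝓞 K) with hx
  obtain ⟨n, hn1, hn2⟩ := exists_mem_Ioc_zpow hpos hE
  -- `s u u_E^{-(n+1)}` has `σ₁ ∈ (E⁻¹, 1]`, hence is `1`
  have hval : ellO ((s * u * unitGen ^ (-(n + 1)) : (𝓞 K)ˣ) : 𝓞 K) = x * (unitE ^ (n + 1))⁻¹ := by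
    rw [Units.val_mul, ellO_mul, ← hx, ellO_units_zpow, ellO_unitGen, zpow_neg]
  have hEn : 0 < unitE ^ (n + 1) := zpow_pos hE0 _
  have h1 : s * u * unitGen ^ (-(n + 1)) = 1 := by
    apply units_eq_one_of_ellO_mem
    · rw [hval]; positivity
    · rw [hval, zpow_add_one₀ hE0.ne', mul_inv, ← mul_assoc]
      have hEn' : 0 < unitE ^ n := zpow_pos hE0 _
      have : 1 < x * (unitE ^ n)⁻¹ := by
        rw [lt_mul_inv_iff₀ hEn', one_mul]; exact hn1
      calc unitE⁻¹ = 1 * unitE⁻¹ := (one_mul _).symm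
        _ < x * (unitE ^ n)⁻¹ * unitE⁻¹ := mul_lt_mul_of_pos_right this (inv_pos.mpr hE0)
    · rw [hval]
      calc x * (unitE ^ (n + 1))⁻¹ ≤ unitE ^ (n + 1) * (unitE ^ (n + 1))⁻¹ :=
            mul_le_mul_of_nonneg_right hn2 (inv_pos.mpr hEn).le
        _ = 1 := mul_inv_cancel₀ hEn.ne'
        _ < unitE := hE
  -- so `u = s⁻¹ u_E^{n+1} = ± u_E^{n+1}`
  have hu : u = s⁻¹ * unitGen ^ (n + 1) := by
    have h2 : s * u = unitGen ^ (n + 1) := by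
      have := congrArg (· * unitGen ^ (n + 1)) h1
      simpa only [mul_assoc, ← zpow_add, neg_add_cancel, zpow_zero, mul_one, one_mul] using this
    rw [← h2, ← mul_assoc, inv_mul_cancel, one_mul]
  refine ⟨n + 1, ?_⟩
  rcases hs with rfl | rfl
  · left; rw [hu, inv_one, one_mul]
  · right; rw [hu]
    rw [show ((-1 : (𝓞 K)ˣ))⁻¹ = -1 from inv_neg_one, neg_one_mul]

/-- `−1` is a torsion unit. [folklore] -/
theorem neg_one_mem_torsion : (-1 : (𝓞 K)ˣ) ∈ torsion K := by
  rw [mem_torsion]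
  intro w
  rw [coe_neg_one, InfinitePlace.coe_apply, AbsoluteValue.map_neg, AbsoluteValue.map_one]

/-- **`(𝓞 K)ˣ` is generated by `u_E` and the torsion `{±1}`.** [folklore] -/
theorem closure_unitGen_sup_torsion : Subgroup.closure {unitGen} ⊔ torsion K = ⊤ := by
  refine top_le_iff.mp fun u _ => ?_
  obtain ⟨n, h⟩ := exists_units_eq_unitGen_zpow u
  have hg : unitGen ^ n ∈ Subgroup.closure ({unitGen} : Set (𝓞 K)ˣ) :=
    Subgroup.zpow_mem _ (Subgroup.subset_closure (Set.mem_singleton _)) n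
  rcases h with h | h
  · rw [h]; exact Subgroup.mem_sup_left hg
  · have h' : u = unitGen ^ n * (-1) := by rw [h, mul_neg_one]
    rw [h']
    exact Subgroup.mul_mem_sup hg neg_one_mem_torsion

/-! ### The regulator `R_K = log E` and `γ₀ = π log E / (3√3)` -/

/-- The one-member family `(u_E)` of units (the unit rank of `K` is `1`). [folklore] -/
def unitFamily : Fin (rank K) → (𝓞 K)ˣ := fun _ => unitGen

/-- The subgroup generated by the family is the one generated by `u_E`. [folklore] -/
theorem closure_range_unitFamily :
    Subgroup.closure (Set.range unitFamily) = Subgroup.closure {unitGen} := by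
  haveI : Nonempty (Fin (rank K)) := ⟨⟨0, by rw [rank_eq_one]; exact one_pos⟩⟩
  show Subgroup.closure (Set.range fun _ : Fin (rank K) => unitGen) = _
  rw [Set.range_const]

/-- The regulator of the family `(u_E)` is the regulator of `K` (the family generates the units
modulo torsion, `regOfFamily_div_regulator`). [folklore] -/
theorem regOfFamily_unitFamily : regOfFamily unitFamily = regulator K := by
  have h := regOfFamily_div_regulator unitFamily
  rw [closure_range_unitFamily, closure_unitGen_sup_torsion, Subgroup.index_top, Nat.cast_one,
    div_eq_one_iff_eq (regulator_ne_zero K)] at h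
  exact h

/-- **The regulator of `K = ℚ(2^{1/3})` is `log E`**, `E = σ₁(u_E)` the least unit `> 1` under the
real embedding (the `1 × 1` regulator determinant at the real place). [folklore] -/
theorem regulator_eq_log_unitE : regulator K = Real.log unitE := by
  classical
  rw [← regOfFamily_unitFamily]
  have hsub : ∀ w : {w : InfinitePlace K // w ≠ wCplx}, w.val = wReal := fun w =>
    (infinitePlace_eq w.val).resolve_right w.prop
  haveI : Subsingleton {w : InfinitePlace K // w ≠ wCplx} :=
    ⟨fun a b => Subtype.ext ((hsub a).trans (hsub b).symm)⟩
  let w₀ : {w : InfinitePlace K // w ≠ wCplx} := ⟨wReal, wReal_ne_wCplx⟩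
  have hc : Fintype.card {w : InfinitePlace K // w ≠ wCplx} = Fintype.card (Fin (rank K)) := by
    rw [Fintype.card_fin, rank_eq_one, Fintype.card_eq_one_iff]
    exact ⟨w₀, fun w => Subsingleton.elim _ _⟩
  rw [regOfFamily_eq_det unitFamily wCplx (Fintype.equivOfCardEq hc),
    Matrix.det_eq_elem_of_subsingleton _ w₀, Matrix.of_apply]
  have hmult : mult w₀.val = 1 := mult_isReal ⟨wReal, isReal_wReal⟩
  have hval : w₀.val ((unitFamily (Fintype.equivOfCardEq hc w₀) : (𝓞 K)ˣ) : K) = unitE := by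
    show wReal (((unitGen : (𝓞 K)ˣ) : 𝓞 K) : K) = unitE
    rw [wReal_apply, realEmbK_coe, ellO_unitGen, abs_of_pos unitE_pos]
  rw [hmult, hval, Nat.cast_one, one_mul, abs_of_pos (Real.log_pos one_lt_unitE)]

/-- `√108 = 6√3`. [folklore] -/
theorem sqrt_108 : Real.sqrt 108 = 6 * Real.sqrt 3 := by
  rw [show (108 : ℝ) = 6 ^ 2 * 3 by norm_num, Real.sqrt_mul (by norm_num), Real.sqrt_sq (by norm_num)]

/-- **`γ₀ = π log E / (3√3)`**: the residue of `ζ_K` at `1` for `K = ℚ(2^{1/3})` by the class number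
formula `γ₀ = 2^{r₁}(2π)^{r₂} h R / (w √|d|)` with `r₁ = r₂ = 1`, `h = 1`, `R = log E`, `w = 2`,
`d = −108` (Heath-Brown p. 6: "`γ₀` is the residue of the pole of the Dedekind zeta-function"; the
value is the Jacobian constant `π v/(3√3)`, `v = log ε₀`, of the computation of `I(β)` on p. 60).
[cite: HeathBrownActa2001, §9 p. 60] -/
theorem gamma₀_eq : gamma₀ = Real.pi * Real.log unitE / (3 * Real.sqrt 3) := by
  rw [gamma₀, dedekindZeta_residue_def, nrRealPlaces_eq_one, nrComplexPlaces_eq_one,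
    regulator_eq_log_unitE, classNumber_eq_one, torsionOrder_eq_two, discr_eq]
  have h108 : Real.sqrt |((-108 : ℤ) : ℝ)| = 6 * Real.sqrt 3 := by
    rw [show |((-108 : ℤ) : ℝ)| = 108 by norm_num, sqrt_108]
  rw [h108]
  have h3 : Real.sqrt 3 ≠ 0 := by positivity
  field_simp
  ring

end Literature.NumberTheory.Sieve.CubicSieve
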